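import Mathlib
import Literature.Analysis.FunctionSpaces.SobolevBallScaling
import Literature.Analysis.FunctionSpaces.SobolevTraceDensityProofs
import Literature.Analysis.FunctionSpaces.SobolevDomainProofs
import Literature.Analysis.FluidPDE.TaoEnstrophyLocalisation
import Literature.Analysis.FluidPDE.VectorCalculus
import HarnessLib

/-!
# Crux `EulerZoomLiouville.PowerGaugeEulerLiouville` (stmt-NavierStokesRegularity-19832), width sub-line `chiral_anchor` (ns-idea-11 g10):
# stub K2 `stub_shellFloor` — THE SHELL HELICITY FLOOR as a tree theorem

Seat ns-ezl-w1 g9 (`--supports stmt-NavierStokesRegularity-19832 --as helper`; LEAD 19832 ns-typeII-p2 g16's key W1-K23, 2026-08-29 10:19Z).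
The sub-line `Cruxes/PowerGaugeEulerLiouville/Lines/chiral_anchor.lean` PROVES its stub K2 in-file (`shellHelicityFloor_holds : ShellHelicityFloor`,
REV2, author ns-idea-11 g10); a Cruxes workfile is not importable by `Theorems/`, so this file PORTS that proof verbatim (credit: ns-idea-11 g10) and
lands the statement δ-unfolded, for the K4 consumer (`stub_anchorRace := ShellHelicityFloor → FarVolumeBound → …`, ns-ezl-w3) and the LEAD's member
`InClass ρ u p H c → IsChiralTubePast u p → False` to cite BY NAME:

* `ChiralAnchor.shellHelicityFloor` — one constant `C` such that for every ball `B(0,R)`, every `C¹` field `v`, every measurable weight `|w| ≤ 1`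
  vanishing off a measurable set `T` of finite volume,
  `|∫_{B_R} w ⟪v, curl v⟫| ≤ C vol(T)^{1/3} (‖Dv‖_{L²(B_R)} + R⁻¹‖v‖_{L²(B_R)}) ‖curl v‖_{L²(B_R)}`
  (pointwise `|w⟪v,curl v⟫| ≤ 𝟙_T‖v‖‖curl v‖`, Cauchy–Schwarz, Hölder `3/2–3`, and the tree's scale-invariant ball Sobolev inequality
  `Literature.Analysis.FunctionSpaces.exists_eLpNorm_le_ball`, `p = 2`, `p′ = 6`, `n = 3`).

Fill of the registered stub (by name): `theorem stub_shellFloor : Sig.stub_shellFloor := …Theorems.PowerGaugeEulerLiouville.ChiralAnchor.shellHelicityFloor`.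

HONEST FRAMING: pure analysis for a width sub-line of the MODEL-lattice crux class; no kill (K4 `stub_anchorRace` is the heart); nothing about the crux E
(19832 OPEN) or NS regularity is proved; not E.
-/

noncomputable section

-- flat `Theorems/<Route><Decl>…` files of one crux share the namespace of the crux (tree convention)
set_option linter.dupNamespace false

open MeasureTheory Set Filter Topology Metric
open scoped ENNReal NNReal ContDiff

namespace Summit.NavierStokesRegularity.NavierStokesRegularity.Theorems.PowerGaugeEulerLiouville.ChiralAnchor

open Literature.Analysis.FunctionSpaces Literature.Analysis.FunctionSpaces.SobolevApprox

/-- Real `L^q` quantity of a continuous function on a ball from its `eLpNorm` (`q ≥ 1`) (line file, K2 proof, ns-idea-11 g10). [folklore] -/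
theorem eLpNorm_restrict_ball_eq_ofReal {G : Type*} [NormedAddCommGroup G] {f : (EuclideanSpace ℝ (Fin 3)) → G} (hf : Continuous f)
    (R : ℝ) {q : ℝ≥0} (hq : 1 ≤ q) :
    eLpNorm f (q : ℝ≥0∞) (volume.restrict (ball (0 : (EuclideanSpace ℝ (Fin 3))) R)) =
      ENNReal.ofReal ((∫ x in ball (0 : (EuclideanSpace ℝ (Fin 3))) R, ‖f x‖ ^ (q : ℝ)) ^ (q : ℝ)⁻¹) := by
  have hmem : MemLp f (q : ℝ≥0∞) (volume.restrict (ball (0 : (EuclideanSpace ℝ (Fin 3))) R)) :=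
    memLp_restrict_of_continuous_of_isBounded (Ω := ⟨ball (0 : (EuclideanSpace ℝ (Fin 3))) R, isOpen_ball⟩) hf isBounded_ball
  have hq0 : (q : ℝ≥0∞) ≠ 0 := by
    have : (0 : ℝ≥0) < q := lt_of_lt_of_le zero_lt_one hq
    exact_mod_cast this.ne'
  rw [hmem.eLpNorm_eq_integral_rpow_norm hq0 ENNReal.coe_ne_top]
  simp

/-- **K2, THE SHELL HELICITY FLOOR** (`ShellHelicityFloor` of `Lines/chiral_anchor.lean`, δ-unfolded; proof ported verbatim from ns-idea-11 g10's
in-file `shellHelicityFloor_holds`, REV2) — pointwise `|w⟪v,curl v⟫| ≤ 𝟙_T‖v‖‖curl v‖`, Cauchy–Schwarz,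
Hölder with exponents `3/2, 3` (`∫_B 𝟙_T‖v‖² ≤ vol(T)^{2/3}‖v‖²_{L⁶(B)}`) and the tree's scale-invariant ball Sobolev inequality
`Literature.Analysis.FunctionSpaces.exists_eLpNorm_le_ball` (`p = 2`, `p' = 6`, `n = 3`; `memSobolevDomain_one_of_contDiff`,
`HasWeakFDerivOn.of_contDiff_holds`).  Constant `C + 1` with `C` the Sobolev constant. [folklore] -/
theorem shellHelicityFloor :
    ∃ C : ℝ, 0 < C ∧ ∀ R : ℝ, 0 < R → ∀ v : (EuclideanSpace ℝ (Fin 3)) → (EuclideanSpace ℝ (Fin 3)), ContDiff ℝ 1 v →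
    ∀ w : (EuclideanSpace ℝ (Fin 3)) → ℝ, Measurable w → (∀ x : (EuclideanSpace ℝ (Fin 3)), |w x| ≤ 1) →
      ∀ T : Set (EuclideanSpace ℝ (Fin 3)), MeasurableSet T → volume T < ⊤ → (∀ x : (EuclideanSpace ℝ (Fin 3)), x ∉ T → w x = 0) →
        |∫ x in Metric.ball (0 : (EuclideanSpace ℝ (Fin 3))) R, w x * inner ℝ (v x) (Literature.Analysis.FluidPDE.curl v x)| ≤
          C * (volume T).toReal ^ (1 / 3 : ℝ) *
              (Real.sqrt (∫ x in Metric.ball (0 : (EuclideanSpace ℝ (Fin 3))) R, ‖fderiv ℝ v x‖ ^ 2) +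
                R⁻¹ * Real.sqrt (∫ x in Metric.ball (0 : (EuclideanSpace ℝ (Fin 3))) R, ‖v x‖ ^ 2)) *
            Real.sqrt (∫ x in Metric.ball (0 : (EuclideanSpace ℝ (Fin 3))) R, ‖Literature.Analysis.FluidPDE.curl v x‖ ^ 2) := by
  classical
  have hfin : (Module.finrank ℝ (EuclideanSpace ℝ (Fin 3)) : ℝ) = 3 := by simp
  obtain ⟨C, hC⟩ := exists_eLpNorm_le_ball (E := (EuclideanSpace ℝ (Fin 3))) (F := (EuclideanSpace ℝ (Fin 3))) (p := 2) (p' := 6) (by norm_num)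
    (by rw [hfin]; norm_num) (by rw [hfin]; norm_num)
  refine ⟨(C : ℝ) + 1, by positivity, fun R hR v hv w hw hw1 T hT hTfin hwT => ?_⟩
  set B : Set (EuclideanSpace ℝ (Fin 3)) := ball (0 : (EuclideanSpace ℝ (Fin 3))) R with hB
  set μ : Measure (EuclideanSpace ℝ (Fin 3)) := volume.restrict B with hμ
  have hBm : MeasurableSet B := measurableSet_ball
  haveI : IsFiniteMeasure μ := by
    rw [hμ]; exact isFiniteMeasure_restrict.2 (measure_ball_lt_top).ne
  set cv : (EuclideanSpace ℝ (Fin 3)) → (EuclideanSpace ℝ (Fin 3)) := Literature.Analysis.FluidPDE.curl v with hcv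
  have hvc : Continuous v := hv.continuous
  have hωc : Continuous cv := by
    rw [hcv, Literature.Analysis.FluidPDE.curl_eq_curlCLM_comp]
    exact Literature.Analysis.FluidPDE.curlCLM.continuous.comp (hv.continuous_fderiv one_ne_zero)
  have hDc : Continuous (fderiv ℝ v) := hv.continuous_fderiv one_ne_zero
  obtain ⟨Mv, hMv⟩ := (isCompact_closedBall (0 : (EuclideanSpace ℝ (Fin 3))) R).exists_bound_of_continuousOn hvc.continuousOn
  obtain ⟨Mω, hMω⟩ := (isCompact_closedBall (0 : (EuclideanSpace ℝ (Fin 3))) R).exists_bound_of_continuousOn hωc.continuousOn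
  set f : (EuclideanSpace ℝ (Fin 3)) → ℝ := fun x => T.indicator (fun _ => (1 : ℝ)) x * ‖v x‖ with hf
  set g : (EuclideanSpace ℝ (Fin 3)) → ℝ := fun x => ‖cv x‖ with hg
  have hind_m : Measurable fun x => T.indicator (fun _ => (1 : ℝ)) x := (measurable_const.indicator hT)
  have hf_m : AEStronglyMeasurable f μ := (hind_m.mul hvc.norm.measurable).aestronglyMeasurable
  have hg_m : AEStronglyMeasurable g μ := hωc.norm.aestronglyMeasurable
  have hind01 : ∀ x, T.indicator (fun _ => (1 : ℝ)) x = 0 ∨ T.indicator (fun _ => (1 : ℝ)) x = 1 := by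
    intro x; by_cases hx : x ∈ T <;> simp [Set.indicator, hx]
  have hind_nn : ∀ x, 0 ≤ T.indicator (fun _ => (1 : ℝ)) x := fun x => by
    rcases hind01 x with h | h <;> simp [h]
  have hind_le : ∀ x, T.indicator (fun _ => (1 : ℝ)) x ≤ 1 := fun x => by
    rcases hind01 x with h | h <;> simp [h]
  have hf_nn : ∀ x, 0 ≤ f x := fun x => mul_nonneg (hind_nn x) (norm_nonneg _)
  have hg_nn : ∀ x, 0 ≤ g x := fun x => norm_nonneg _
  have hpt : ∀ x, ‖w x * inner ℝ (v x) (cv x)‖ ≤ f x * g x := by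
    intro x
    rw [norm_mul, Real.norm_eq_abs]
    by_cases hx : x ∈ T
    · have : T.indicator (fun _ => (1 : ℝ)) x = 1 := by simp [hx]
      rw [hf, hg]; simp only [this, one_mul]
      calc |w x| * ‖inner ℝ (v x) (cv x)‖ ≤ 1 * (‖v x‖ * ‖cv x‖) :=
            mul_le_mul (hw1 x) (norm_inner_le_norm _ _) (norm_nonneg _) zero_le_one
        _ = ‖v x‖ * ‖cv x‖ := one_mul _
    · rw [hwT x hx]; simp [mul_nonneg (hf_nn x) (hg_nn x)]
  have hB_sub : B ⊆ closedBall (0 : (EuclideanSpace ℝ (Fin 3))) R := ball_subset_closedBall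
  have hf_bd : ∀ᵐ x ∂μ, ‖f x‖ ≤ Mv := by
    rw [hμ]; refine ae_restrict_of_forall_mem hBm fun x hx => ?_
    rw [Real.norm_of_nonneg (hf_nn x), hf]
    calc T.indicator (fun _ => (1 : ℝ)) x * ‖v x‖ ≤ 1 * ‖v x‖ :=
          mul_le_mul_of_nonneg_right (hind_le x) (norm_nonneg _)
      _ = ‖v x‖ := one_mul _
      _ ≤ Mv := hMv x (hB_sub hx)
  have hg_bd : ∀ᵐ x ∂μ, ‖g x‖ ≤ Mω := by
    rw [hμ]; refine ae_restrict_of_forall_mem hBm fun x hx => ?_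
    rw [hg, Real.norm_of_nonneg (norm_nonneg _)]; exact hMω x (hB_sub hx)
  have hf2 : MemLp f 2 μ := MemLp.of_bound hf_m Mv hf_bd
  have hg2 : MemLp g 2 μ := MemLp.of_bound hg_m Mω hg_bd
  have hfg_int : Integrable (fun x => f x * g x) μ := hf2.integrable_mul hg2
  have hCS : |∫ x, w x * inner ℝ (v x) (cv x) ∂μ| ≤
      Real.sqrt (∫ x, f x ^ 2 ∂μ) * Real.sqrt (∫ x, g x ^ 2 ∂μ) := by
    calc |∫ x, w x * inner ℝ (v x) (cv x) ∂μ|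
        = ‖∫ x, w x * inner ℝ (v x) (cv x) ∂μ‖ := (Real.norm_eq_abs _).symm
      _ ≤ ∫ x, ‖w x * inner ℝ (v x) (cv x)‖ ∂μ := norm_integral_le_integral_norm _
      _ ≤ ∫ x, f x * g x ∂μ :=
          integral_mono_of_nonneg (ae_of_all _ fun x => norm_nonneg _) hfg_int (ae_of_all _ hpt)
      _ ≤ (∫ x, f x ^ (2 : ℝ) ∂μ) ^ (1 / (2 : ℝ)) * (∫ x, g x ^ (2 : ℝ) ∂μ) ^ (1 / (2 : ℝ)) :=
          integral_mul_le_Lp_mul_Lq_of_nonneg Real.HolderConjugate.two_two (ae_of_all _ hf_nn)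
            (ae_of_all _ hg_nn) (by simpa using hf2) (by simpa using hg2)
      _ = Real.sqrt (∫ x, f x ^ 2 ∂μ) * Real.sqrt (∫ x, g x ^ 2 ∂μ) := by
          simp only [Real.rpow_two, Real.sqrt_eq_rpow]
  have hf_sq : ∀ x, f x ^ 2 = T.indicator (fun _ => (1 : ℝ)) x * ‖v x‖ ^ 2 := by
    intro x; rcases hind01 x with h | h <;> simp [hf, h]
  have hMv0 : 0 ≤ Mv := (norm_nonneg _).trans (hMv 0 (mem_closedBall_self hR.le))
  have hind32 : MemLp (fun x => T.indicator (fun _ => (1 : ℝ)) x) (ENNReal.ofReal (3 / 2)) μ :=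
    MemLp.of_bound hind_m.aestronglyMeasurable 1
      (ae_of_all _ fun x => by rw [Real.norm_of_nonneg (hind_nn x)]; exact hind_le x)
  have hv2_m : AEStronglyMeasurable (fun x => ‖v x‖ ^ 2) μ :=
    (hvc.norm.pow 2).aestronglyMeasurable
  have hv2_bd : ∀ᵐ x ∂μ, ‖‖v x‖ ^ 2‖ ≤ Mv ^ 2 := by
    rw [hμ]; refine ae_restrict_of_forall_mem hBm fun x hx => ?_
    rw [Real.norm_of_nonneg (by positivity)]
    exact pow_le_pow_left₀ (norm_nonneg _) (hMv x (hB_sub hx)) 2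
  have hv2_3 : MemLp (fun x => ‖v x‖ ^ 2) (ENNReal.ofReal 3) μ := MemLp.of_bound hv2_m (Mv ^ 2) hv2_bd
  have hp32 : (3 / 2 : ℝ).HolderConjugate 3 := by rw [Real.holderConjugate_iff]; norm_num
  have hH := integral_mul_le_Lp_mul_Lq_of_nonneg hp32 (ae_of_all _ hind_nn)
    (ae_of_all _ fun x => by positivity) hind32 hv2_3
  have hind_rpow : ∀ x, T.indicator (fun _ => (1 : ℝ)) x ^ (3 / 2 : ℝ) = T.indicator (fun _ => (1 : ℝ)) x := by
    intro x; rcases hind01 x with h | h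
    · rw [h, Real.zero_rpow (by norm_num)]
    · rw [h, Real.one_rpow]
  have hvolTB : ∫ x, T.indicator (fun _ => (1 : ℝ)) x ∂μ ≤ (volume T).toReal := by
    have h1 : ∫ x, T.indicator (fun _ => (1 : ℝ)) x ∂μ = μ.real T := integral_indicator_one hT
    rw [h1, measureReal_def, hμ, Measure.restrict_apply hT]
    exact ENNReal.toReal_mono hTfin.ne (measure_mono inter_subset_left)
  have hvolT0 : 0 ≤ (volume T).toReal := ENNReal.toReal_nonneg
  have hv6 : ∀ x, (‖v x‖ ^ 2) ^ (3 : ℝ) = ‖v x‖ ^ (6 : ℝ) := by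
    intro x
    rw [show (3 : ℝ) = ((3 : ℕ) : ℝ) by norm_num, Real.rpow_natCast,
      show (6 : ℝ) = ((6 : ℕ) : ℝ) by norm_num, Real.rpow_natCast, ← pow_mul]
  have hI2le : ∫ x, f x ^ 2 ∂μ ≤ (volume T).toReal ^ (2 / 3 : ℝ) * (∫ x, ‖v x‖ ^ (6 : ℝ) ∂μ) ^ (1 / 3 : ℝ) := by
    have hlhs : ∫ x, f x ^ 2 ∂μ = ∫ x, T.indicator (fun _ => (1 : ℝ)) x * ‖v x‖ ^ 2 ∂μ :=
      integral_congr_ae (ae_of_all _ hf_sq)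
    rw [hlhs]
    refine hH.trans ?_
    simp only [hind_rpow, hv6]
    have h23 : (1 / (3 / 2 : ℝ)) = (2 / 3 : ℝ) := by norm_num
    rw [h23]
    have hI6nn : 0 ≤ (∫ x, ‖v x‖ ^ (6 : ℝ) ∂μ) ^ (1 / 3 : ℝ) := Real.rpow_nonneg (integral_nonneg fun x => by positivity) _
    exact mul_le_mul_of_nonneg_right (Real.rpow_le_rpow (integral_nonneg fun x => hind_nn x) hvolTB (by norm_num)) hI6nn
  have hSob := hC 0 R hR v (fderiv ℝ v)
    (memSobolevDomain_one_of_contDiff (Ω := ⟨B, isOpen_ball⟩) hv isBounded_ball)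
    (HasWeakFDerivOn.of_contDiff_holds (E' := (EuclideanSpace ℝ (Fin 3))) (F := (EuclideanSpace ℝ (Fin 3))) ⟨B, isOpen_ball⟩ volume hv)
  have e6 := eLpNorm_restrict_ball_eq_ofReal (G := (EuclideanSpace ℝ (Fin 3))) hvc R (q := 6) (by norm_num)
  have e2 := eLpNorm_restrict_ball_eq_ofReal (G := (EuclideanSpace ℝ (Fin 3))) hvc R (q := 2) (by norm_num)
  have e2' := eLpNorm_restrict_ball_eq_ofReal (G := (EuclideanSpace ℝ (Fin 3)) →L[ℝ] (EuclideanSpace ℝ (Fin 3))) hDc R (q := 2) (by norm_num)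
  set I6r : ℝ := (∫ x, ‖v x‖ ^ ((6 : ℝ≥0) : ℝ) ∂μ) ^ ((6 : ℝ≥0) : ℝ)⁻¹ with hI6r
  set I2r : ℝ := (∫ x, ‖v x‖ ^ ((2 : ℝ≥0) : ℝ) ∂μ) ^ ((2 : ℝ≥0) : ℝ)⁻¹ with hI2r
  set J2r : ℝ := (∫ x, ‖fderiv ℝ v x‖ ^ ((2 : ℝ≥0) : ℝ) ∂μ) ^ ((2 : ℝ≥0) : ℝ)⁻¹ with hJ2r
  have hI6r0 : 0 ≤ I6r := Real.rpow_nonneg (integral_nonneg fun x => by positivity) _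
  have hI2r0 : 0 ≤ I2r := Real.rpow_nonneg (integral_nonneg fun x => by positivity) _
  have hJ2r0 : 0 ≤ J2r := Real.rpow_nonneg (integral_nonneg fun x => by positivity) _
  have hS : I6r ≤ (C : ℝ) * (R⁻¹ * I2r + J2r) := by
    have h := hSob
    rw [← hB, ← hμ] at h
    rw [e6, e2, e2'] at h
    rw [← ENNReal.ofReal_inv_of_pos hR,
      ← ENNReal.ofReal_mul (inv_nonneg.2 hR.le), ← ENNReal.ofReal_add (by positivity) hJ2r0,
      ← ENNReal.ofReal_coe_nnreal, ← ENNReal.ofReal_mul (NNReal.coe_nonneg C)] at h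
    exact (ENNReal.ofReal_le_ofReal_iff (by positivity)).1 h
  have hI2r_eq : I2r = Real.sqrt (∫ x, ‖v x‖ ^ 2 ∂μ) := by
    simp only [hI2r, NNReal.coe_ofNat, Real.rpow_two, Real.sqrt_eq_rpow, one_div]
  have hJ2r_eq : J2r = Real.sqrt (∫ x, ‖fderiv ℝ v x‖ ^ 2 ∂μ) := by
    simp only [hJ2r, NNReal.coe_ofNat, Real.rpow_two, Real.sqrt_eq_rpow, one_div]
  have hI6int0 : 0 ≤ ∫ x, ‖v x‖ ^ (6 : ℝ) ∂μ := integral_nonneg fun x => by positivity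
  have hsqrt6 : Real.sqrt ((∫ x, ‖v x‖ ^ (6 : ℝ) ∂μ) ^ (1 / 3 : ℝ)) = I6r := by
    rw [hI6r, Real.sqrt_eq_rpow, ← Real.rpow_mul hI6int0]
    norm_num
  have hsqrtT : Real.sqrt ((volume T).toReal ^ (2 / 3 : ℝ)) = (volume T).toReal ^ (1 / 3 : ℝ) := by
    rw [Real.sqrt_eq_rpow, ← Real.rpow_mul hvolT0]
    norm_num
  have hsqf : Real.sqrt (∫ x, f x ^ 2 ∂μ) ≤ (volume T).toReal ^ (1 / 3 : ℝ) * I6r := by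
    calc Real.sqrt (∫ x, f x ^ 2 ∂μ)
        ≤ Real.sqrt ((volume T).toReal ^ (2 / 3 : ℝ) * (∫ x, ‖v x‖ ^ (6 : ℝ) ∂μ) ^ (1 / 3 : ℝ)) :=
          Real.sqrt_le_sqrt hI2le
      _ = (volume T).toReal ^ (1 / 3 : ℝ) * I6r := by
          rw [Real.sqrt_mul (Real.rpow_nonneg hvolT0 _), hsqrt6, hsqrtT]
  have hg_eq : (∫ x, g x ^ 2 ∂μ) = ∫ x, ‖cv x‖ ^ 2 ∂μ := rfl
  have hT13 : 0 ≤ (volume T).toReal ^ (1 / 3 : ℝ) := Real.rpow_nonneg hvolT0 _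
  have hsg0 : 0 ≤ Real.sqrt (∫ x, ‖cv x‖ ^ 2 ∂μ) := Real.sqrt_nonneg _
  have hsum0 : 0 ≤ Real.sqrt (∫ x, ‖fderiv ℝ v x‖ ^ 2 ∂μ) + R⁻¹ * Real.sqrt (∫ x, ‖v x‖ ^ 2 ∂μ) := by
    positivity
  calc |∫ x, w x * inner ℝ (v x) (cv x) ∂μ|
      ≤ Real.sqrt (∫ x, f x ^ 2 ∂μ) * Real.sqrt (∫ x, g x ^ 2 ∂μ) := hCS
    _ ≤ ((volume T).toReal ^ (1 / 3 : ℝ) * I6r) * Real.sqrt (∫ x, ‖cv x‖ ^ 2 ∂μ) := by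
        rw [hg_eq]; exact mul_le_mul_of_nonneg_right hsqf hsg0
    _ ≤ ((volume T).toReal ^ (1 / 3 : ℝ) * ((C : ℝ) * (R⁻¹ * I2r + J2r))) *
          Real.sqrt (∫ x, ‖cv x‖ ^ 2 ∂μ) := by gcongr
    _ = (C : ℝ) * (volume T).toReal ^ (1 / 3 : ℝ) *
          (Real.sqrt (∫ x, ‖fderiv ℝ v x‖ ^ 2 ∂μ) + R⁻¹ * Real.sqrt (∫ x, ‖v x‖ ^ 2 ∂μ)) *
          Real.sqrt (∫ x, ‖cv x‖ ^ 2 ∂μ) := by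
        rw [hI2r_eq, hJ2r_eq]; ring
    _ ≤ ((C : ℝ) + 1) * (volume T).toReal ^ (1 / 3 : ℝ) *
          (Real.sqrt (∫ x, ‖fderiv ℝ v x‖ ^ 2 ∂μ) + R⁻¹ * Real.sqrt (∫ x, ‖v x‖ ^ 2 ∂μ)) *
          Real.sqrt (∫ x, ‖cv x‖ ^ 2 ∂μ) := by
        have hC1 : (C : ℝ) ≤ (C : ℝ) + 1 := by linarith
        gcongr


end Summit.NavierStokesRegularity.NavierStokesRegularity.Theorems.PowerGaugeEulerLiouville.ChiralAnchor

end
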